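import Summits.HodgeConjecture.HodgeConjecture.Theorems.Ring2HypothesesWeilComponentsSplit
import Summits.HodgeConjecture.HodgeConjecture.Theorems.Ring2AbelianAllTypeIIIFourfolds
import Summits.HodgeConjecture.HodgeConjecture.Theorems.Ring2AbelianAllWeilDiscriminantProduct
import Summits.HodgeConjecture.HodgeConjecture.Theorems.Ring2AbelianAllWeilCellsInhabited
import Summits.HodgeConjecture.HodgeConjecture.Theorems.Ring2AbelianAllWeilDiscriminantDescent
import Literature.AlgebraicGeometry.VanGeemen1994.HyperbolicOfSplitDiscriminant
import Literature.AlgebraicGeometry.VanGeemen1994.WeilDiscriminantOfHyperbolic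
import Literature.AlgebraicGeometry.VanGeemen1994.WeilDiscriminantOfProductTop
import Literature.AlgebraicGeometry.Motives.SegreHyperplaneClass
import Literature.AlgebraicGeometry.Motives.RationalDegreeOneModel
import Literature.AlgebraicGeometry.HodgeTheory.HolomorphicBundleChernCharacterProjectiveSpace
import HarnessLib

/-!
# Ring 2 · AbelianAll (seat `ab-weil-2`, gen 4) — EVEN × EVEN: the product of two even-dimensional Weil pairs is SPLIT
  iff-direction `δ_A · δ_B = [(-1)^{n_A + n_B}] ⟹ split`; split × split is split; two members of ONE component have a split product

HONEST FRAMING (sub-cell `pub-hodge-ring2-ab-*`, verbatim): research route, not a corollary; conditional on HC_CM plus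
one named minimal statement. (Cell `pub-hodge-ring2`, verbatim: research route conditional on HC_CM; not a corollary;
Q11.4-sentence-2 already refuted in dim ≥ 3.) `HC_CM` does not occur here. No definition, no named fact, no `sorry`; §3
takes the refereed Floccari–Fu 2026 Thm. 1.2 / a split cell of the Weil tower as BINDERS.

WHAT IS PROVED. The fourth and last shape of the product-discriminant calculus of this seat (`Ring2AbelianAllOddTimesCurve`:
odd × curve; `Ring2AbelianAllOddTimesOdd`: odd × odd; `Ring2AbelianAllSelfProduct`: the square `A × A`): products `A × B`
of two EVEN-dimensional pairs `(A, φ)`, `(B, ψ)` (`dim A = 2n_A`, `dim B = 2n_B`, `φ² = ψ² = -d`). Here no re-weighting of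
the product polarization can change the class (`c^{2n} ∈ Nm K^×`), so the discriminant classes `δ_A`, `δ_B` of the
factors' `K`-symmetrised hyperplane classes enter the statement:

* §1 `exists_segreEmbedding_prod_of_classes` — the Segre embedding of two GIVEN projective embeddings `e_A`, `e_B` with
  GIVEN non-zero rational ambient classes `a_A`, `a_B` (Hartshorne II Ex. 5.11–5.12 on `H²` of complex points): a
  projective embedding `e` of `A × B` and a rational `a ≠ 0` with `e^*a = pr_A^*(e_A^*a_A) + c · pr_B^*(e_B^*a_B)` for
  some `c ∈ ℚ^×` (`H²(ℙᴺ(ℂ); ℂ)` is a line spanned by a rational class, so `a_A`, `a_B` are rational multiples of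
  the Segre-additive generators of `Motives.exists_segreHyperplaneClasses`);
* §2 **`isSplitWeilType_prod_of_hasWeilDiscriminantNondeg`** — if the `K`-symmetrised hyperplane classes `h_A`, `h_B` of
  `(A, φ, e_A, a_A)`, `(B, ψ, e_B, a_B)` have non-degenerate discriminant classes `δ_A`, `δ_B ∈ ℚˣ/Nm(K_dˣ)` with
  `δ_A · δ_B = [(-1)^{n_A + n_B}]` and `(A × B, φ × ψ)` is of Weil type `(n_A + n_B, n_A + n_B)`, then `(A × B, φ × ψ)` is
  of SPLIT Weil type: the `K`-symmetrisation of the Segre class of §1 is `pr_A^* h_A + pr_B^*(c·h_B)`, its class is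
  `δ_A · δ_B` ("det H is multiplicative", ab-weil-1's `hasWeilDiscriminantNondeg_prod`; `c·h_B` has the class of
  `h_B`), and Landherr's converse on the carriers (`VanGeemen1994.IsWeilType.isSplitWeilType_of_hasWeilDiscriminantNondeg_split`);
* §3 consequences — **`isSplitWeilType_prod_of_isSplitWeilType`: SPLIT × SPLIT IS SPLIT** (no hypothesis beyond the two
  split pairs: Weil type is additive, `isWeilType_prod`, and a hyperbolic class has discriminant `[(-1)ⁿ]`,
  `hasWeilDiscriminantNondeg_neg_one_pow_of_isHyperbolicWeilType`); **`isSplitWeilType_prod_of_class_eq`: two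
  equidimensional pairs lying in the SAME component `(n, d, δ)` have a SPLIT product** (`δ² = [1] = [(-1)^{2n}]`; for
  `A = B` this is the square theorem of `Ring2AbelianAllSelfProduct` without re-proving it); the product of two Weil
  FOURFOLD members of one component `(2, d, δ)` is a split `(4,4)` eightfold; the product `S × S′` of two Weil-type SURFACE
  members of one component `(1, d, δ)` carries a `HasDiscOneWeilStructure` — HC for all powers of `S × S′` modulo
  Floccari–Fu alone; Weil classes of all these products from the split cell alone.

With ab-weil-1's multiplicativity, the split/non-split status of the PRODUCT POLARIZATIONS of every product of two Weil
pairs over the same `K` is now decided in the kernel: odd × curve and odd × odd always split (parity), even × even split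
iff `δ_A δ_B = [(-1)^{n_A+n_B}]` (this file proves ⟸; ⟹ for the product classes is `hasWeilDiscriminantNondeg_prod` read
with `IsNonsplitWeilType.ne_split_of_hasWeilDiscriminantNondeg`).

PRINT COMPARISON (cell referee F-ab-58, 2026-08-20; docstring-only revision, statements and proofs unchanged). The instance
`(n_A, n_B) = (2, 1)` of `isSplitWeilType_prod_of_hasWeilDiscriminantNondeg` — a Weil-type FOURFOLD of arbitrary discriminant
`δ` times a Weil-type SURFACE pair of the complementary class `-δ` is a SPLIT `(3,3)` sixfold — is the kernel form of the
sixfold construction in E. Markman, arXiv:2509.23403 §11.5 Step 2 (preprint, UNREFEREED; one paragraph, our proof): "for every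
polarized abelian fourfold `(A₁, η₁, h₁)` of Weil type, of arbitrary discriminant, there exists a polarized abelian surface of Weil
type `(A₂, η₂, h₂)`, such that the discriminant of their product … is the coset of `-1` … the sixfold is hence of split type"
(in the tree the EXISTENCE of such a surface — the CM square `E₀²` with weights — is `Motives.aimedSplitProduct_cmSquare_of_pos`;
the binder-free corollary for GIVEN factors is `isSplitWeilType_fourfold_prod_surface_of_class_mul_eq` in
`Ring2AbelianAllEvenTimesEvenComponents`). What is NOT proved here or there: the DESCENT "the Weil classes of `A₁` are algebraic
as soon as those of `A₁ × A₂` are" (Markman loc. cit. citing [schoen]; the cell's open `WeilDiscriminantDescent` line) — this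
file only produces split products, never algebraicity of a factor's classes.

## References

* [vanGeemen1994HodgeAV] B. van Geemen, LNM 1594 (1994), Lemma 5.2 (2)–(4), 5.4 and (5.4.1).
* [Landherr1936HermitianForms] W. Landherr, Abh. Math. Sem. Hamburg 11 (1936) 245–248.
* [Hartshorne1977] R. Hartshorne, Algebraic Geometry, II Ex. 5.11–5.12.
* [HatcherAT2002] A. Hatcher, Algebraic Topology (2002), Thm. 3.19 (`H•(ℂℙᴺ)`).
* [FloccariFu2026] S. Floccari, L. Fu, J. Math. Pures Appl. 210 (2026) 103876, Thm. 1.2.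
* [Markman2025SurveySecant] E. Markman, arXiv:2509.23403, §11.5 (product polarizations and discriminants; preprint).
-/

set_option linter.dupNamespace false

noncomputable section

open CategoryTheory MonoidalCategory

namespace Summit.HodgeConjecture.HodgeConjecture.Ring2.AbelianAll

open Literature.AlgebraicGeometry Literature.AlgebraicGeometry.Motives
open Literature.AlgebraicGeometry.Motives.SegreHyperplaneClass
open Literature.AlgebraicGeometry.HodgeTheory Literature.AlgebraicGeometry.VanGeemen1994
open Literature.AlgebraicTopology.SingularHomology
open Literature.Geometry.Kaehler
open Summit.HodgeConjecture.HodgeConjecture.WeilTypeLadder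
open Summit.HodgeConjecture.HodgeConjecture.Theses
open Summit.HodgeConjecture.HodgeConjecture.Ring2.Hypotheses

/-! ## §1 The Segre embedding of two given embedded abelian varieties with given ambient classes -/

/-- A non-zero class in `H²(ℙᴸ(ℂ); ℂ)` forces `L ≥ 1` (`H²` of the point `ℙ⁰(ℂ)` vanishes: degree `2 > 2·0`).
[cite: HatcherAT2002, Thm. 3.19] -/
theorem one_le_of_ne_zero_projectiveSpace_two {L : ℕ} {x : complexBetti (projectiveSpace L ℂ) 2} (hx : x ≠ 0) :
    1 ≤ L := by
  by_contra hL
  obtain rfl : L = 0 := by omega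
  haveI : Subsingleton (complexBetti (projectiveSpace 0 ℂ) 2) :=
    Motives.ComplexPoints.subsingleton_singularCohomology_of_lt (isSmoothProjective_projectiveSpace' 0) ℂ
      (k := 2) (by omega)
  exact hx (Subsingleton.elim _ _)

/-- **The Segre embedding of `A × B` built from GIVEN embeddings and GIVEN ambient classes** (Hartshorne II
Ex. 5.11–5.12: `σ^*𝒪(1) = 𝒪(1,1)`, on `H²` of complex points). For projective embeddings `e_A : A ↪ ℙᴺ`, `e_B : B ↪ ℙᴹ`
and non-zero rational classes `a_A ∈ H²(ℙᴺ(ℂ))`, `a_B ∈ H²(ℙᴹ(ℂ))` there are a projective embedding `e` of `A × B`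
(namely `(e_A ⊗ e_B) ≫ σ`), a non-zero rational ambient class `a` and `c ∈ ℚ^×` with
`e^*a = pr_A^*(e_A^*a_A) + c · pr_B^*(e_B^*a_B)`: `H²(ℙᴺ(ℂ); ℂ)` (`N ≥ 1`) is a line spanned by the rational
Segre-additive generator `g_N` (`Motives.exists_segreHyperplaneClasses`), so `a_A = q_A g_N`, `a_B = q_B g_M` with
`q_A, q_B ∈ ℚ^×`, and `a = q_A · g`, `c = q_A / q_B`. [cite: Hartshorne1977, II Ex. 5.11 and Ex. 5.12]
[cite: HatcherAT2002, Thm. 3.19] -/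
theorem exists_segreEmbedding_prod_of_classes (A B : AbelianVariety ℂ)
    (eA : ProjectiveEmbedding A.X) {aA : complexBetti (projectiveSpace eA.n ℂ) 2} (haA : IsRationalClass aA)
    (haA0 : aA ≠ 0)
    (eB : ProjectiveEmbedding B.X) {aB : complexBetti (projectiveSpace eB.n ℂ) 2} (haB : IsRationalClass aB)
    (haB0 : aB ≠ 0) :
    ∃ (e : ProjectiveEmbedding (A.prod B).X) (a : complexBetti (projectiveSpace e.n ℂ) 2) (c : ℚ),
      IsRationalClass a ∧ a ≠ 0 ∧ c ≠ 0 ∧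
      complexBetti.map e.ι 2 a =
        complexBetti.map (AbelianVariety.fst A B).hom.hom.hom 2 (complexBetti.map eA.ι 2 aA) +
          ((c : ℚ) : ℂ) • complexBetti.map (AbelianVariety.snd A B).hom.hom.hom 2 (complexBetti.map eB.ι 2 aB) := by
  obtain ⟨g, hgr, hgnz, hgσ⟩ := exists_segreHyperplaneClasses
  have hN : 1 ≤ eA.n := one_le_of_ne_zero_projectiveSpace_two haA0
  have hM : 1 ≤ eB.n := one_le_of_ne_zero_projectiveSpace_two haB0
  -- `a_A = q_A g_N`, `a_B = q_B g_M` with rational non-zero `q_A`, `q_B`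
  obtain ⟨zA, hzA⟩ := (finrank_eq_one_iff_of_nonzero' (g eA.n) (hgnz _ hN)).1
    (finrank_complexBetti_projectiveSpace_two_mul_eq_one eA.n (p := 1) hN) aA
  obtain ⟨zB, hzB⟩ := (finrank_eq_one_iff_of_nonzero' (g eB.n) (hgnz _ hM)).1
    (finrank_complexBetti_projectiveSpace_two_mul_eq_one eB.n (p := 1) hM) aB
  obtain ⟨qA, hqA⟩ := exists_ratCast_eq_of_isRationalClass_smul (hgr _) (hgnz _ hN) (z := zA) (by rw [hzA]; exact haA)
  obtain ⟨qB, hqB⟩ := exists_ratCast_eq_of_isRationalClass_smul (hgr _) (hgnz _ hM) (z := zB) (by rw [hzB]; exact haB)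
  subst hqA hqB
  have hqA0 : qA ≠ 0 := by
    rintro rfl
    exact haA0 (by rw [← hzA, Rat.cast_zero, zero_smul])
  have hqB0 : qB ≠ 0 := by
    rintro rfl
    exact haB0 (by rw [← hzB, Rat.cast_zero, zero_smul])
  -- the Segre embedding of `e_A ⊗ e_B`
  obtain ⟨e, hle, he⟩ := exists_projectiveEmbedding_prod g hgσ eA eB
  have hen : 1 ≤ e.n := hM.trans hle
  refine ⟨e, ((qA : ℚ) : ℂ) • g e.n, qA / qB, (hgr _).smul qA, smul_ne_zero (by exact_mod_cast hqA0) (hgnz _ hen),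
    div_ne_zero hqA0 hqB0, ?_⟩
  rw [map_smul, he, ← hzA, ← hzB, smul_add, map_smul, map_smul, map_smul, map_smul, smul_smul, Rat.cast_div,
    div_mul_cancel₀ _ (by exact_mod_cast hqB0 : ((qB : ℚ) : ℂ) ≠ 0)]

/-! ## §2 Even × even: `δ_A · δ_B = [(-1)^{n_A + n_B}]` makes the product split -/

/-- **EVEN × EVEN.** Let `(A, φ)`, `(B, ψ)` be complex abelian varieties of EVEN dimensions `2n_A`, `2n_B` (`n_A, n_B ≥ 1`)
with `φ ≫ φ = -(d • 𝟙 A)`, `ψ ≫ ψ = -(d • 𝟙 B)`, projective embeddings `e_A`, `e_B` and non-zero rational ambient classes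
`a_A`, `a_B` whose `K`-symmetrised hyperplane classes `h_A = d·e_A^*a_A + φ^*e_A^*a_A`, `h_B` have NON-DEGENERATE
discriminant classes `δ_A`, `δ_B ∈ ℚˣ/Nm(K_dˣ)` (`VanGeemen1994.HasWeilDiscriminantNondeg`). If `(A × B, φ × ψ)` is of Weil
type `(n_A + n_B, n_A + n_B)` and `δ_A · δ_B = [(-1)^{n_A + n_B}]`, then `(A × B, φ × ψ)` is of SPLIT Weil type. Proof: the
`K`-symmetrisation of the Segre class of `exists_segreEmbedding_prod_of_classes` is `pr_A^* h_A + pr_B^*(c · h_B)`;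
`c · h_B` has the class of `h_B` (`hasWeilDiscriminantNondeg_ratCast_smul_iff`); "det H is multiplicative"
(`hasWeilDiscriminantNondeg_prod`, the top self-intersections being non-zero by `VanGeemen1994.prod_kFrames_top_ne_zero`)
gives the class `δ_A · δ_B = [(-1)^{n_A+n_B}]`; Landherr's converse on the carriers. No named fact.
[cite: vanGeemen1994HodgeAV, Lemma 5.2 (2)–(4), 5.4 and (5.4.1)] [cite: Landherr1936HermitianForms]
[cite: Hartshorne1977, II Ex. 5.11 and Ex. 5.12] -/
theorem isSplitWeilType_prod_of_hasWeilDiscriminantNondeg {A B : AbelianVariety ℂ} {φ : A ⟶ A} {ψ : B ⟶ B}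
    {nA nB d : ℕ} (hnA : 0 < nA) (hnB : 0 < nB) (hA : A.dim = 2 * nA) (hB : B.dim = 2 * nB)
    (hφ : φ ≫ φ = -(d • 𝟙 A)) (hψ : ψ ≫ ψ = -(d • 𝟙 B))
    (eA : ProjectiveEmbedding A.X) {aA : complexBetti (projectiveSpace eA.n ℂ) 2} (haA : IsRationalClass aA)
    (haA0 : aA ≠ 0)
    (eB : ProjectiveEmbedding B.X) {aB : complexBetti (projectiveSpace eB.n ℂ) 2} (haB : IsRationalClass aB)
    (haB0 : aB ≠ 0) {δA δB : weilNormResidueGroup d}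
    (hWA : HasWeilDiscriminantNondeg A φ nA d
      ((d : ℂ) • complexBetti.map eA.ι 2 aA + complexBetti.map φ.hom.hom.hom 2 (complexBetti.map eA.ι 2 aA)) δA)
    (hWB : HasWeilDiscriminantNondeg B ψ nB d
      ((d : ℂ) • complexBetti.map eB.ι 2 aB + complexBetti.map ψ.hom.hom.hom 2 (complexBetti.map eB.ι 2 aB)) δB)
    (hW : IsWeilType (A.prod B)
      (AbelianVariety.prodLift (AbelianVariety.fst A B ≫ φ) (AbelianVariety.snd A B ≫ ψ)) (nA + nB) d)
    (hδ : δA * δB = QuotientGroup.mk ((-1 : ℚˣ) ^ (nA + nB))) :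
    IsSplitWeilType (A.prod B)
      (AbelianVariety.prodLift (AbelianVariety.fst A B ≫ φ) (AbelianVariety.snd A B ≫ ψ)) (nA + nB) d := by
  classical
  set Φ := AbelianVariety.prodLift (AbelianVariety.fst A B ≫ φ) (AbelianVariety.snd A B ≫ ψ) with hΦ
  have hd : 0 < d := hW.d_pos
  set hKA := (d : ℂ) • complexBetti.map eA.ι 2 aA + complexBetti.map φ.hom.hom.hom 2 (complexBetti.map eA.ι 2 aA)
    with hKAdef
  set hKB := (d : ℂ) • complexBetti.map eB.ι 2 aB + complexBetti.map ψ.hom.hom.hom 2 (complexBetti.map eB.ι 2 aB)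
    with hKBdef
  -- (1) the Segre embedding with the given classes and its `K`-symmetrisation
  obtain ⟨e, a, c, ha, ha0, hc0, he⟩ := exists_segreEmbedding_prod_of_classes A B eA haA haA0 eB haB haB0
  have hh : (d : ℂ) • complexBetti.map e.ι 2 a + complexBetti.map Φ.hom.hom.hom 2 (complexBetti.map e.ι 2 a) =
      complexBetti.map (AbelianVariety.fst A B).hom.hom.hom 2 hKA +
        complexBetti.map (AbelianVariety.snd A B).hom.hom.hom 2 (((c : ℚ) : ℂ) • hKB) := by
    rw [he, map_add, map_smul, map_prodLift_map_fst φ ψ 2, map_prodLift_map_snd φ ψ 2, hKAdef, hKBdef]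
    simp only [map_add, map_smul, smul_add, smul_smul]
    rw [mul_comm ((c : ℚ) : ℂ) (d : ℂ)]
    abel
  -- (2) `c · h_B` has the class of `h_B`; rationality
  have hWB' : HasWeilDiscriminantNondeg B ψ nB d (((c : ℚ) : ℂ) • hKB) δB :=
    (hasWeilDiscriminantNondeg_ratCast_smul_iff hc0).2 hWB
  have hrA : IsRationalClass hKA := isRationalClass_ksymm d φ eA haA
  have hrB' : IsRationalClass (((c : ℚ) : ℂ) • hKB) := (isRationalClass_ksymm d ψ eB haB).smul c
  -- (3) the top self-intersections of `h_A`, `c · h_B` do not vanish (non-degeneracy of `Q_{h_K}` on `A × B`)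
  have hAdim : A.dim = 2 * nA - 1 + 1 := by omega
  have hBdim : B.dim = 2 * nB - 1 + 1 := by omega
  have hXA : IsSmoothProjective (2 * nA - 1 + 1) A.X := isSmoothProjective_of_dim_eq' hAdim
  have hXB : IsSmoothProjective (2 * nB - 1 + 1) B.X := isSmoothProjective_of_dim_eq' hBdim
  obtain ⟨xA, ωA, amA, bmA, qA, hxA, hiA, hωA, hωA0, hQA, -, -⟩ := id hWA
  obtain ⟨xB, ωB, amB, bmB, qB, hxB, hiB, hωB, hωB0, hQB, -, -⟩ := id hWB'
  obtain ⟨dA, hdA⟩ := exists_eq_ratCast_smul_of_finrank_eq_one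
    (Motives.finrank_complexBetti_two_add_two_mul_eq_one hXA) hωA hωA0
    (HodgeRiemannDegreeOne.IsRationalClass.lefschetzPow hrA (2 * nA - 1) hrA)
  obtain ⟨dB, hdB⟩ := exists_eq_ratCast_smul_of_finrank_eq_one
    (Motives.finrank_complexBetti_two_add_two_mul_eq_one hXB) hωB hωB0
    (HodgeRiemannDegreeOne.IsRationalClass.lefschetzPow hrB' (2 * nB - 1) hrB')
  obtain ⟨hdA0, hdB0⟩ := prod_kFrames_top_ne_zero (N := nA + nB) hAdim hBdim (by omega) (by omega) (by omega)
    (by omega) hd hφ hψ xA hxA hiA hKA ωA amA bmA hQA dA hdA xB hxB hiB _ ωB amB bmB hQB dB hdB e ha ha0 hh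
  have htA : lefschetzPow hKA (2 * nA - 1) 2 hKA ≠ 0 := by
    rw [hdA]; exact smul_ne_zero (by exact_mod_cast hdA0) hωA0
  have htB : lefschetzPow (((c : ℚ) : ℂ) • hKB) (2 * nB - 1) 2 (((c : ℚ) : ℂ) • hKB) ≠ 0 := by
    rw [hdB]; exact smul_ne_zero (by exact_mod_cast hdB0) hωB0
  -- (4) "det H is multiplicative": class `δ_A · δ_B = [(-1)^{n_A + n_B}]` on the product class
  obtain ⟨hprod, -⟩ := hasWeilDiscriminantNondeg_prod hnA hnB hA hB hrA hrB' htA htB hWA hWB'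
  rw [hδ, ← hh] at hprod
  -- (5) Landherr's converse on the carriers
  exact VanGeemen1994.IsWeilType.isSplitWeilType_of_hasWeilDiscriminantNondeg_split hW e ha ha0 hprod

/-! ## §3 Consequences -/

/-- **SPLIT × SPLIT IS SPLIT.** If `(A, φ)` is of split Weil type `(n_A, d)` and `(B, ψ)` of split Weil type `(n_B, d)`, then
`(A × B, φ × ψ)` is of split Weil type `(n_A + n_B, d)` — no further hypothesis: Weil type is additive (`isWeilType_prod`), a
hyperbolic `K`-symmetrised hyperplane class has non-degenerate discriminant `[(-1)ⁿ]`
(`VanGeemen1994.hasWeilDiscriminantNondeg_neg_one_pow_of_isHyperbolicWeilType`), and `[(-1)^{n_A}]·[(-1)^{n_B}] = [(-1)^{n_A+n_B}]`.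
[cite: vanGeemen1994HodgeAV, Lemma 5.2 (2)–(4), 5.4 and (5.4.1)] [cite: Landherr1936HermitianForms] -/
theorem isSplitWeilType_prod_of_isSplitWeilType {A B : AbelianVariety ℂ} {φ : A ⟶ A} {ψ : B ⟶ B} {nA nB d : ℕ}
    (hSA : IsSplitWeilType A φ nA d) (hSB : IsSplitWeilType B ψ nB d) :
    IsSplitWeilType (A.prod B)
      (AbelianVariety.prodLift (AbelianVariety.fst A B ≫ φ) (AbelianVariety.snd A B ≫ ψ)) (nA + nB) d := by
  obtain ⟨hnA, hd, hA, hφ, eA, aA, haA, haA0, hhA⟩ := isSplitWeilType_iff.1 hSA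
  obtain ⟨hnB, -, hB, hψ, eB, aB, haB, haB0, hhB⟩ := isSplitWeilType_iff.1 hSB
  refine isSplitWeilType_prod_of_hasWeilDiscriminantNondeg hnA hnB hA hB hφ hψ eA haA haA0 eB haB haB0
    (hasWeilDiscriminantNondeg_neg_one_pow_of_isHyperbolicWeilType hnA hA hd hφ eA haA haA0 hhA)
    (hasWeilDiscriminantNondeg_neg_one_pow_of_isHyperbolicWeilType hnB hB hd hψ eB haB haB0 hhB)
    (isWeilType_prod hSA.isWeilType hSB.isWeilType) ?_
  rw [← QuotientGroup.mk_mul, ← pow_add]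

/-- Every class of `ℚˣ/Nm(K_dˣ)` is `2`-torsion (`u² = Nm(u)`). [cite: vanGeemen1994HodgeAV, 4.14] -/
theorem weilNormResidueGroup_mul_self {d : ℕ} (δ : weilNormResidueGroup d) : δ * δ = 1 := by
  induction δ using QuotientGroup.induction_on with
  | H q => rw [← QuotientGroup.mk_mul, QuotientGroup.eq_one_iff, ← sq]; exact sq_mem_normUnitsSubgroup_weilField d q

/-- **Two equidimensional pairs in the SAME component `(n, d, δ)` have a SPLIT product**: `dim A = dim B = 2n`, the
`K`-symmetrised hyperplane classes of `(A, φ, e_A, a_A)` and `(B, ψ, e_B, a_B)` both of non-degenerate class `δ`, and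
`(A × B, φ × ψ)` of Weil type `(2n, 2n)` — then `(A × B, φ × ψ)` is of split Weil type (`δ · δ = [1] = [(-1)^{2n}]`). For `A = B`,
`φ = ψ` this is `Ring2AbelianAllSelfProduct.isSplitWeilType_self_prod`, now for two different members.
[cite: vanGeemen1994HodgeAV, Lemma 5.2 (2)–(4), 5.4 and (5.4.1)] [cite: Landherr1936HermitianForms] -/
theorem isSplitWeilType_prod_of_class_eq {A B : AbelianVariety ℂ} {φ : A ⟶ A} {ψ : B ⟶ B} {n d : ℕ} (hn : 0 < n)
    (hA : A.dim = 2 * n) (hB : B.dim = 2 * n) (hφ : φ ≫ φ = -(d • 𝟙 A)) (hψ : ψ ≫ ψ = -(d • 𝟙 B))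
    (eA : ProjectiveEmbedding A.X) {aA : complexBetti (projectiveSpace eA.n ℂ) 2} (haA : IsRationalClass aA)
    (haA0 : aA ≠ 0)
    (eB : ProjectiveEmbedding B.X) {aB : complexBetti (projectiveSpace eB.n ℂ) 2} (haB : IsRationalClass aB)
    (haB0 : aB ≠ 0) {δ : weilNormResidueGroup d}
    (hWA : HasWeilDiscriminantNondeg A φ n d
      ((d : ℂ) • complexBetti.map eA.ι 2 aA + complexBetti.map φ.hom.hom.hom 2 (complexBetti.map eA.ι 2 aA)) δ)
    (hWB : HasWeilDiscriminantNondeg B ψ n d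
      ((d : ℂ) • complexBetti.map eB.ι 2 aB + complexBetti.map ψ.hom.hom.hom 2 (complexBetti.map eB.ι 2 aB)) δ)
    (hW : IsWeilType (A.prod B)
      (AbelianVariety.prodLift (AbelianVariety.fst A B ≫ φ) (AbelianVariety.snd A B ≫ ψ)) (n + n) d) :
    IsSplitWeilType (A.prod B)
      (AbelianVariety.prodLift (AbelianVariety.fst A B ≫ φ) (AbelianVariety.snd A B ≫ ψ)) (n + n) d := by
  refine isSplitWeilType_prod_of_hasWeilDiscriminantNondeg hn hn hA hB hφ hψ eA haA haA0 eB haB haB0 hWA hWB hW ?_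
  have h2 : ((-1 : ℚˣ) ^ (n + n)) = 1 := by rw [← two_mul, pow_mul, neg_one_sq, one_pow]
  rw [weilNormResidueGroup_mul_self, h2, QuotientGroup.mk_one]

/-- Same component, with the Weil type of the product DERIVED from the Weil types `(n, n)` of the two factors
(`isWeilType_prod`). [cite: vanGeemen1994HodgeAV, Lemma 5.2 (2)–(4) and (5.4.1)] -/
theorem isSplitWeilType_prod_of_class_eq_of_isWeilType {A B : AbelianVariety ℂ} {φ : A ⟶ A} {ψ : B ⟶ B} {n d : ℕ}
    (hWA' : IsWeilType A φ n d) (hWB' : IsWeilType B ψ n d)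
    (eA : ProjectiveEmbedding A.X) {aA : complexBetti (projectiveSpace eA.n ℂ) 2} (haA : IsRationalClass aA)
    (haA0 : aA ≠ 0)
    (eB : ProjectiveEmbedding B.X) {aB : complexBetti (projectiveSpace eB.n ℂ) 2} (haB : IsRationalClass aB)
    (haB0 : aB ≠ 0) {δ : weilNormResidueGroup d}
    (hWA : HasWeilDiscriminantNondeg A φ n d
      ((d : ℂ) • complexBetti.map eA.ι 2 aA + complexBetti.map φ.hom.hom.hom 2 (complexBetti.map eA.ι 2 aA)) δ)
    (hWB : HasWeilDiscriminantNondeg B ψ n d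
      ((d : ℂ) • complexBetti.map eB.ι 2 aB + complexBetti.map ψ.hom.hom.hom 2 (complexBetti.map eB.ι 2 aB)) δ) :
    IsSplitWeilType (A.prod B)
      (AbelianVariety.prodLift (AbelianVariety.fst A B ≫ φ) (AbelianVariety.snd A B ≫ ψ)) (n + n) d :=
  isSplitWeilType_prod_of_class_eq hWA'.pos hWA'.dim_eq hWB'.dim_eq hWA'.sq_eq hWB'.sq_eq eA haA haA0 eB haB haB0
    hWA hWB (isWeilType_prod hWA' hWB')

/-- **The Weil classes of a product of two split pairs are algebraic granted the split cell `(n_A + n_B, d, [(-1)^{n_A+n_B}])`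
ALONE** (binder `h`). [cite: vanGeemen1994HodgeAV, Lemma 5.2 and (5.4.1)] -/
theorem weilClasses_algebraic_prod_of_isSplitWeilType_of_split_component {A B : AbelianVariety ℂ} {φ : A ⟶ A}
    {ψ : B ⟶ B} {nA nB d : ℕ} (h : WeilClassesComponent (nA + nB) d (splitDiscriminantClass (nA + nB) d))
    (hSA : IsSplitWeilType A φ nA d) (hSB : IsSplitWeilType B ψ nB d)
    {c : complexBetti (A.prod B).X (2 * (nA + nB))} (hcQ : IsRationalClass c)
    (hcH : IsOfHodgeType (2 * (nA + nB)) (A.prod B).X (2 * (nA + nB)) (nA + nB) (nA + nB) c)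
    (hw : c ∈ weilClassesOf (A.prod B)
      (AbelianVariety.prodLift (AbelianVariety.fst A B ≫ φ) (AbelianVariety.snd A B ≫ ψ)) (nA + nB) d) :
    c ∈ algebraicClasses (A.prod B).X (nA + nB) :=
  weilClasses_algebraic_of_isSplitWeilType_of_split_component h (isSplitWeilType_prod_of_isSplitWeilType hSA hSB)
    hcQ hcH hw

/-- **Two Weil FOURFOLD members of one component `(2, d, δ)` have a SPLIT `(4,4)` eightfold product** — e.g. two NON-split
Weil-type fourfolds `X₂`, `X₂′` over the same `K` with the same discriminant class (the second cross power of the atlas cell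
`HodgePowersOfWeilTypeFourfold` sits in the split eightfold cell, like the square `X₂ × X₂` of `Ring2AbelianAllSelfProduct`).
[cite: vanGeemen1994HodgeAV, Lemma 5.2 and (5.4.1)] [cite: Landherr1936HermitianForms] -/
theorem isSplitWeilType_fourfold_prod_fourfold_of_class_eq {A B : AbelianVariety ℂ} {φ : A ⟶ A} {ψ : B ⟶ B} {d : ℕ}
    (hWA' : IsWeilType A φ 2 d) (hWB' : IsWeilType B ψ 2 d)
    (eA : ProjectiveEmbedding A.X) {aA : complexBetti (projectiveSpace eA.n ℂ) 2} (haA : IsRationalClass aA)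
    (haA0 : aA ≠ 0)
    (eB : ProjectiveEmbedding B.X) {aB : complexBetti (projectiveSpace eB.n ℂ) 2} (haB : IsRationalClass aB)
    (haB0 : aB ≠ 0) {δ : weilNormResidueGroup d}
    (hWA : HasWeilDiscriminantNondeg A φ 2 d
      ((d : ℂ) • complexBetti.map eA.ι 2 aA + complexBetti.map φ.hom.hom.hom 2 (complexBetti.map eA.ι 2 aA)) δ)
    (hWB : HasWeilDiscriminantNondeg B ψ 2 d
      ((d : ℂ) • complexBetti.map eB.ι 2 aB + complexBetti.map ψ.hom.hom.hom 2 (complexBetti.map eB.ι 2 aB)) δ) :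
    IsSplitWeilType (A.prod B)
      (AbelianVariety.prodLift (AbelianVariety.fst A B ≫ φ) (AbelianVariety.snd A B ≫ ψ)) 4 d :=
  isSplitWeilType_prod_of_class_eq_of_isWeilType hWA' hWB' eA haA haA0 eB haB haB0 hWA hWB

/-- **The product `S × S′` of two Weil-type SURFACE members of one component `(1, d, δ)` carries a discriminant-1 Weil
structure** (`HasDiscOneWeilStructure`, the Floccari–Fu input): `(S, φ)`, `(S′, ψ)` of Weil type `(1, d)` whose
`K`-symmetrised hyperplane classes have the same non-degenerate class `δ`. For `S = S′` this is
`Ring2AbelianAllSelfProduct.hasDiscOneWeilStructure_surface_sq`. No named fact. [cite: vanGeemen1994HodgeAV, Lemma 5.2 and (5.4.1)]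
[cite: FloccariFu2026, p. 3] -/
theorem hasDiscOneWeilStructure_surface_prod_surface_of_class_eq {S S' : AbelianVariety ℂ} {φ : S ⟶ S} {ψ : S' ⟶ S'}
    {d : ℕ} (hWS : IsWeilType S φ 1 d) (hWS' : IsWeilType S' ψ 1 d)
    (eS : ProjectiveEmbedding S.X) {aS : complexBetti (projectiveSpace eS.n ℂ) 2} (haS : IsRationalClass aS)
    (haS0 : aS ≠ 0)
    (eS' : ProjectiveEmbedding S'.X) {aS' : complexBetti (projectiveSpace eS'.n ℂ) 2} (haS' : IsRationalClass aS')
    (haS'0 : aS' ≠ 0) {δ : weilNormResidueGroup d}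
    (hδS : HasWeilDiscriminantNondeg S φ 1 d
      ((d : ℂ) • complexBetti.map eS.ι 2 aS + complexBetti.map φ.hom.hom.hom 2 (complexBetti.map eS.ι 2 aS)) δ)
    (hδS' : HasWeilDiscriminantNondeg S' ψ 1 d
      ((d : ℂ) • complexBetti.map eS'.ι 2 aS' + complexBetti.map ψ.hom.hom.hom 2 (complexBetti.map eS'.ι 2 aS')) δ) :
    HasDiscOneWeilStructure (S.prod S') := by
  obtain ⟨-, hd, -, hΦ2, e, a, ha, ha0, hh⟩ :=
    isSplitWeilType_iff.1 (isSplitWeilType_prod_of_class_eq_of_isWeilType hWS hWS' eS haS haS0 eS' haS' haS'0 hδS hδS')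
  exact ⟨_, d, e, a, hd, hΦ2, ha, ha0, hh⟩

/-- **HC for ALL POWERS of `S × S′`, two Weil-type surface members of one component `(1, d, δ)`, modulo Floccari–Fu 2026
Thm. 1.2 ALONE** (binder `h5`). [cite: FloccariFu2026, Theorem 1.2] -/
theorem hodgeConjectureFor_powSucc_surface_prod_surface_of_floccariFu
    (h5 : FloccariFu2026_hodgeClasses_algebraic_powers_discOneWeilFourfold)
    {S S' : AbelianVariety ℂ} {φ : S ⟶ S} {ψ : S' ⟶ S'} {d : ℕ} (hWS : IsWeilType S φ 1 d) (hWS' : IsWeilType S' ψ 1 d)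
    (eS : ProjectiveEmbedding S.X) {aS : complexBetti (projectiveSpace eS.n ℂ) 2} (haS : IsRationalClass aS)
    (haS0 : aS ≠ 0)
    (eS' : ProjectiveEmbedding S'.X) {aS' : complexBetti (projectiveSpace eS'.n ℂ) 2} (haS' : IsRationalClass aS')
    (haS'0 : aS' ≠ 0) {δ : weilNormResidueGroup d}
    (hδS : HasWeilDiscriminantNondeg S φ 1 d
      ((d : ℂ) • complexBetti.map eS.ι 2 aS + complexBetti.map φ.hom.hom.hom 2 (complexBetti.map eS.ι 2 aS)) δ)
    (hδS' : HasWeilDiscriminantNondeg S' ψ 1 d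
      ((d : ℂ) • complexBetti.map eS'.ι 2 aS' + complexBetti.map ψ.hom.hom.hom 2 (complexBetti.map eS'.ι 2 aS')) δ)
    (N : ℕ) :
    HodgeConjectureFor ((S.prod S').powSucc N).dim ((S.prod S').powSucc N).X :=
  hodgeConjectureFor_powSucc_of_floccariFu_of_hasDiscOneWeilStructure h5 (S.prod S')
    (by rw [AbelianVariety.dim_prod, hWS.dim_eq, hWS'.dim_eq])
    (hasDiscOneWeilStructure_surface_prod_surface_of_class_eq hWS hWS' eS haS haS0 eS' haS' haS'0 hδS hδS') N

/-- **Products of two split Weil-type SURFACE pairs** (`(S, φ)`, `(S′, ψ)` of split Weil type `(1, d)`, i.e. each carrying a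
hyperbolic `K`-symmetrised hyperplane class, discriminant `[-1]`) carry a discriminant-1 Weil structure; HC for all powers of
`S × S′` modulo Floccari–Fu alone. [cite: FloccariFu2026, Theorem 1.2] [cite: vanGeemen1994HodgeAV, (5.4.1)] -/
theorem hodgeConjectureFor_powSucc_surface_prod_surface_of_floccariFu_of_isSplitWeilType
    (h5 : FloccariFu2026_hodgeClasses_algebraic_powers_discOneWeilFourfold)
    {S S' : AbelianVariety ℂ} {φ : S ⟶ S} {ψ : S' ⟶ S'} {d : ℕ} (hS : IsSplitWeilType S φ 1 d)
    (hS' : IsSplitWeilType S' ψ 1 d) (N : ℕ) :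
    HodgeConjectureFor ((S.prod S').powSucc N).dim ((S.prod S').powSucc N).X := by
  obtain ⟨-, hd, -, hΦ2, e, a, ha, ha0, hh⟩ := isSplitWeilType_iff.1 (isSplitWeilType_prod_of_isSplitWeilType hS hS')
  exact hodgeConjectureFor_powSucc_of_floccariFu_of_hasDiscOneWeilStructure h5 (S.prod S')
    (by rw [AbelianVariety.dim_prod, hS.isWeilType.dim_eq, hS'.isWeilType.dim_eq]) ⟨_, d, e, a, hd, hΦ2, ha, ha0, hh⟩ N

end Summit.HodgeConjecture.HodgeConjecture.Ring2.AbelianAll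

end
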